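import Summits.ResolutionOfSingularities.ResolutionOfSingularities.Theorems.HilbertSamuelEliminationSigmaMaxModificationsCorridor3WLadderIsoKernelCurveShadow
import Summits.ResolutionOfSingularities.ResolutionOfSingularities.Theorems.HilbertSamuelEliminationSigmaMaxModificationsCorridor3WLadderIsoTailsTowerDrop
import HarnessLib

/-!
# [OURS · L1 W4.2] NO ISOLATED E3 POINT TOWER FOLLOWS A CURVE — POINT FORM (the curve given by its generic points: `c 0 ≠ pt 0`, nothing strictly
# between `c 0` and `pt 0`)

Crux chain w42 (`SigmaMaxModifications`, stmt-ResolutionOfSingularities-18506; conjunct `SigmaMaxModificationsCorridor3`, stmt-…-19249),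
line `w_ladder`, registered stub `stub_isoSepRecurrent` of skeleton v8.8; kernel census «no isolated point tower follows a curve», file 5 (point form of
file 4 `…IsoKernelCurveShadow`). Lead res-L1-w42-lead-1 (gen 6). Helper file `--supports stmt-ResolutionOfSingularities-19249`; kernel only (no
definition, no named fact).

WHAT IS PROVED. The two ideal-theoretic hypotheses of `false_of_isIsoPointTower_of_curveShadow` / `eventually_free_rational_of_curveShadow` — «the
prime `P` of `c 0` in `𝒪_{X_0,pt 0}` is not maximal» and «`dim 𝒪_{X_0,pt 0}⧸P ≤ 1`» — follow from the POINT data «`c 0 ≠ pt 0`» and «no point `z` with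
`c 0 ⤳ z ⤳ pt 0` other than the two» (`comap_stalkSpecializes_ne_maximalIdeal`, `krullDimLE_one_quotient_of_immediate`: the points of `Spec 𝒪_{X,x}` are
the generizations of `x`, `Spec 𝒪_{X,x} → X` is an embedding — Mathlib `Scheme.range_fromSpecStalk`, `IsPreimmersion`). Hence
`false_of_isIsoPointTower_of_curveThrough` and `eventually_free_rational_of_curveThrough`, and the census form at ANY stage
`false_of_isIsoPointTower_of_curveThrough_drop` (dropped tower `T.drop a`, res-type-012's `IsIsoPointTower.drop` / `isMaximalOrigin_drop`).

HONEST FRAMING. OURS bookkeeping over Mathlib's `Spec 𝒪_{X,x} → X`; nothing here is a statement of H. Hironaka's manuscript [Hironaka2017] nor of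
[CossartJannsenSaito2020] / [CossartPiltant2009]. AI-written; AI review is weaker than expert review.
References: The Stacks Project, Tag 01J7 [StacksProject]; J. Kollár, *Lectures on Resolution of Singularities*, §1.4 [Kollar2007].
-/

noncomputable section

set_option linter.dupNamespace false

open IsLocalRing
open Literature.AlgebraicGeometry.Resolution

namespace Summit.ResolutionOfSingularities.ResolutionOfSingularities.Cruxes.SigmaMaxModifications.IdeasL1C5

universe u

section Points

open AlgebraicGeometry CategoryTheory TopologicalSpace
open Literature.AlgebraicGeometry.CossartJannsenSaito2020
open Summit.ResolutionOfSingularities.ResolutionOfSingularities.Theorems.CampaignW42 (IsMaximalOrigin)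
open Summit.ResolutionOfSingularities.ResolutionOfSingularities.Cruxes.SigmaMaxModifications.IdeasL1Idea2R4 (IsIsoPointTower)

variable {T : BlowupTower.{u}} {pt : ∀ n, T.X n}

/-! ### The curve in point terms: `c 0 ≠ pt 0` and no point strictly between them -/

/-- For a generization `y ⤳ x` with `y ≠ x`, the prime of `y` in `𝒪_{X,x}` is not the maximal ideal. [cite: StacksProject, Tag 01J7] -/
theorem comap_stalkSpecializes_ne_maximalIdeal {X : Scheme.{u}} {y x : X} (h : y ⤳ x) (hne : y ≠ x) :
    (maximalIdeal (X.presheaf.stalk y)).comap (X.presheaf.stalkSpecializes h).hom ≠ maximalIdeal (X.presheaf.stalk x) := by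
  intro heq
  apply hne
  let p : Spec (X.presheaf.stalk x) := Spec.map (X.presheaf.stalkSpecializes h) (closedPoint (X.presheaf.stalk y))
  have hp : (X.fromSpecStalk x).base p = y := by
    change (Spec.map (X.presheaf.stalkSpecializes h) ≫ X.fromSpecStalk x).base (closedPoint _) = y
    rw [Scheme.SpecMap_stalkSpecializes_fromSpecStalk h]
    exact Scheme.fromSpecStalk_closedPoint
  have hpc : p = closedPoint (X.presheaf.stalk x) := by
    apply PrimeSpectrum.ext
    change ((maximalIdeal (X.presheaf.stalk y)).comap (X.presheaf.stalkSpecializes h).hom) = maximalIdeal _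
    exact heq
  rw [hpc] at hp
  rw [← hp]
  exact Scheme.fromSpecStalk_closedPoint

/-- If no point lies strictly between a generization `y ⤳ x` and `x`, the prime `P` of `y` in `𝒪_{X,x}` has `dim 𝒪_{X,x}⧸P ≤ 1` (points of
`Spec 𝒪_{X,x}` = generizations of `x`, `Spec 𝒪_{X,x} → X` an embedding). [cite: StacksProject, Tag 01J7] -/
theorem krullDimLE_one_quotient_of_immediate {X : Scheme.{u}} {y x : X} (h : y ⤳ x)
    (himm : ∀ z : X, y ⤳ z → z ⤳ x → z = y ∨ z = x) :
    Ring.KrullDimLE 1 (X.presheaf.stalk x ⧸ (maximalIdeal (X.presheaf.stalk y)).comap (X.presheaf.stalkSpecializes h).hom) := by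
  set P := (maximalIdeal (X.presheaf.stalk y)).comap (X.presheaf.stalkSpecializes h).hom with hP
  haveI hPp : P.IsPrime := Ideal.comap_isPrime _ _
  haveI : IsDomain (X.presheaf.stalk x ⧸ P) := Ideal.Quotient.isDomain P
  rw [Ring.krullDimLE_one_iff_of_noZeroDivisors]
  intro I hI0 hIp
  set Q : Ideal (X.presheaf.stalk x) := I.comap (Ideal.Quotient.mk P) with hQ
  haveI hQp : Q.IsPrime := Ideal.comap_isPrime _ _
  have hPQ : P ≤ Q := fun a ha => by
    rw [hQ, Ideal.mem_comap, Ideal.Quotient.eq_zero_iff_mem.mpr ha]; exact I.zero_mem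
  have hIQ : I = Q.map (Ideal.Quotient.mk P) := (Ideal.map_comap_of_surjective _ Ideal.Quotient.mk_surjective I).symm
  have hQP : Q ≠ P := by
    intro hQP
    apply hI0
    rw [hIQ, hQP, Ideal.map_quotient_self]
  -- the points `p ⤳ q ⤳ closed` of `Spec 𝒪_{X,x}` and their images `y ⤳ z ⤳ x`
  let f := X.fromSpecStalk x
  let p : Spec (X.presheaf.stalk x) := Spec.map (X.presheaf.stalkSpecializes h) (closedPoint (X.presheaf.stalk y))
  have hpP : p.asIdeal = P := rfl
  let q : Spec (X.presheaf.stalk x) := ⟨Q, hQp⟩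
  have hfp : f.base p = y := by
    change (Spec.map (X.presheaf.stalkSpecializes h) ≫ X.fromSpecStalk x).base (closedPoint _) = y
    rw [Scheme.SpecMap_stalkSpecializes_fromSpecStalk h]
    exact Scheme.fromSpecStalk_closedPoint
  have hfc : f.base (closedPoint _) = x := Scheme.fromSpecStalk_closedPoint
  have hpq : p ⤳ q := (PrimeSpectrum.le_iff_specializes p q).mp (by change p.asIdeal ≤ Q; rw [hpP]; exact hPQ)
  have hqc : q ⤳ closedPoint _ :=
    (PrimeSpectrum.le_iff_specializes q _).mp (by change Q ≤ maximalIdeal _; exact IsLocalRing.le_maximalIdeal hQp.ne_top)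
  have hyz : y ⤳ f.base q := by
    have h1 := hpq.map f.continuous
    rwa [hfp] at h1
  have hzx : f.base q ⤳ x := by
    have h1 := hqc.map f.continuous
    rwa [hfc] at h1
  have hz := himm (f.base q) hyz hzx
  have hinj : Function.Injective f.base := f.isEmbedding.injective
  rcases hz with hz | hz
  · exact absurd (congrArg PrimeSpectrum.asIdeal (hinj (hz.trans hfp.symm))) hQP
  · have hqm : Q = maximalIdeal _ := congrArg PrimeSpectrum.asIdeal (hinj (hz.trans hfc.symm))
    rcases Ideal.map_eq_top_or_isMaximal_of_surjective (Ideal.Quotient.mk P) Ideal.Quotient.mk_surjective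
        (I := Q) (hqm ▸ IsLocalRing.maximalIdeal.isMaximal _) with htop | hmax
    · exact absurd (hIQ.symm ▸ htop) hIp.ne_top
    · rwa [← hIQ] at hmax

/-- **NO ISOLATED E3 POINT TOWER FOLLOWS A CURVE — point form.** As `false_of_isIsoPointTower_of_curveShadow`, the curve being given by its generic
points `c n` (`c (n+1) ↦ c n`, `c n ⤳ pt n`) with `c 0 ≠ pt 0` and NO POINT STRICTLY BETWEEN `c 0` and `pt 0` (the closure of `c 0` has dimension
one at `pt 0`). [cite: CossartPiltant2009, ch. 3 I.9] [cite: StacksProject, Tag 01J7] -/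
theorem false_of_isIsoPointTower_of_curveThrough {p : ℕ} {ν : ℕ → ℕ} (hint : ∀ n, IsIntegral (T.X n))
    (hO : IsMaximalOrigin p 3 ν (T.X 0) (pt 0)) (hT : IsIsoPointTower 3 ν T pt)
    (c : ∀ n, T.X n) (hc : ∀ n, (T.π n).base (c (n + 1)) = c n) (hcs : ∀ n, c n ⤳ pt n) (hne : c 0 ≠ pt 0)
    (himm : ∀ z : T.X 0, c 0 ⤳ z → z ⤳ pt 0 → z = c 0 ∨ z = pt 0) : False :=
  false_of_isIsoPointTower_of_curveShadow hint hO hT c hc hcs (comap_stalkSpecializes_ne_maximalIdeal (hcs 0) hne)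
    (krullDimLE_one_quotient_of_immediate (hcs 0) himm)

/-- **ANY point tower following a curve (point form) is eventually free-rational.** [cite: Kollar2007, §1.4] [cite: StacksProject, Tag 01J7] -/
theorem eventually_free_rational_of_curveThrough (hint : ∀ n, IsIntegral (T.X n))
    (hC : ∀ n, T.C n = {pt n}) (hpt : ∀ n, (T.π n).base (pt (n + 1)) = pt n) (hcl : ∀ n, IsClosed ({pt n} : Set (T.X n)))
    (c : ∀ n, T.X n) (hc : ∀ n, (T.π n).base (c (n + 1)) = c n) (hcs : ∀ n, c n ⤳ pt n) (hne : c 0 ≠ pt 0)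
    (himm : ∀ z : T.X 0, c 0 ⤳ z → z ⤳ pt 0 → z = c 0 ∨ z = pt 0) :
    ∃ n₀, ∀ n, n₀ ≤ n → IsRationalStep T pt n ∧ ¬ IsSatelliteStep T pt n :=
  eventually_free_rational_of_curveShadow hint hC hpt hcl c hc hcs (comap_stalkSpecializes_ne_maximalIdeal (hcs 0) hne)
    (krullDimLE_one_quotient_of_immediate (hcs 0) himm)

/-- **… through ANY stage**: no isolated E3 point tower has, from some stage `a` on, its marked points on the strict transforms of a curve through
`x_a` (apply the stage-`0` form to the dropped tower `T.drop a`, again an isolated E3 point tower over a maximal origin —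
`IsIsoPointTower.drop` / `isMaximalOrigin_drop`). This is the census statement «every counterexample tower is CURVE-FREE at every stage».
[cite: CossartPiltant2009, ch. 3 I.9] [cite: CossartJannsenSaito2020, Def. 6.39] -/
theorem false_of_isIsoPointTower_of_curveThrough_drop {p : ℕ} {ν : ℕ → ℕ} (hint : ∀ n, IsIntegral (T.X n))
    (hO : IsMaximalOrigin p 3 ν (T.X 0) (pt 0)) (hT : IsIsoPointTower 3 ν T pt) (a : ℕ)
    (c : ∀ n, (T.drop a).X n) (hc : ∀ n, ((T.drop a).π n).base (c (n + 1)) = c n) (hcs : ∀ n, c n ⤳ pt (a + n))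
    (hne : c 0 ≠ pt (a + 0))
    (himm : ∀ z : T.X (a + 0), c 0 ⤳ z → z ⤳ pt (a + 0) → z = c 0 ∨ z = pt (a + 0)) : False :=
  false_of_isIsoPointTower_of_curveThrough (T := T.drop a) (pt := fun n => pt (a + n)) (fun n => hint (a + n))
    (hT.isMaximalOrigin_drop hO a) (hT.drop a) c hc hcs hne himm

end Points

end Summit.ResolutionOfSingularities.ResolutionOfSingularities.Cruxes.SigmaMaxModifications.IdeasL1C5

end
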